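import Literature.AlgebraicGeometry.Morphisms.FlatProjectiveFamilyHilbertPolynomialConstant
import HarnessLib

/-!
# The Hilbert polynomial of a FLAT projective family is LOCALLY CONSTANT on ANY Noetherian base (Hartshorne III Thm. 9.9, EGA III 7.9.11)

Layer `Literature/AlgebraicGeometry/Morphisms`, namespace `Literature.AlgebraicGeometry.Morphisms`.  Theorems only: no definition, no
named fact, no instance, no notation, no `sorry`.  Universe `0` (that of ★ `Morphisms/FlatProjectiveFamilyHilbertPolynomialConstant`).

THE PRINT.  Hartshorne III Thm. 9.9: «`T` integral noetherian, `X ⊆ ℙⁿ_T` closed and flat over `T` ⇒ the Hilbert polynomial `P_t` of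
the fibre `X_t` is independent of `t`»; without «integral», `t ↦ P_t` is LOCALLY CONSTANT (EGA III 7.9.11; Hartshorne, *Connectedness
of the Hilbert scheme* (1966) Thm. 1.2; Mumford, *Curves on an Algebraic Surface*, Lect. 8, 3° (ii)).  Reduction: `P_t` is constant
along every specialisation `t₀ ⤳ t` (9.9 for the family pulled back to the integral closed subscheme `Spec (A ⧸ 𝔭_{t₀})`), and on a
noetherian sober space a function constant along specialisations is locally constant.  Currency of ★
`FlatProjectiveFamilyHilbertPolynomialConstant`: `ι : Z ⟶ 𝐏ʳ_A = ProjCech.PP A r` a closed immersion, `strZ ι` proper and flat,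
`𝒪_Z(e) := SerreTwist.twistMod ι (unitModule Z) e`, field points `x : Spec K ⟶ Spec A` with cartesian squares `(k, f₀)` and the two
LETTERS `Ext¹(𝒪_{X₀}, k^*𝒪_Z(e)) = 0`, `dim_K Γ(X₀, k^*𝒪_Z(e)) = P(e)`.

* §0 `isLocallyConstant_of_specializes` (Mathlib only): Noetherian + quasi-sober, constant along `⤳` ⇒ locally constant.
* §1 `exists_embedding_of_isPullback` — the base change of the embedded family along ANY ring map `A → B` is an embedded family
  `ι_B : Z_B ⟶ 𝐏ʳ_B` with `g^*𝒪_Z(e) ≅ 𝒪_{Z_B}(e)` (★ `ProjBaseChangeAny.isPullback_projMap'`, ★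
  `SerreTwist.exists_pullback_twistMod_iso_of_sq`); `exists_lift_fieldPoint` — field points of `Spec B` read through it.
* §2 **`hilbertPolynomial_eq_of_le`** — SPECIALISATION: for primes `𝔭 ≤ 𝔮` of a Noetherian `A`, the polynomials reading the ranks at
  the `κ(𝔭)`- and `κ(𝔮)`-fibres for `e ≫ 0` coincide (★ `exists_polynomial_forall_fieldPoint_pullback_twistMod'` over `A ⧸ 𝔭`).
* §3 **`exists_isLocallyConstant_hilbertPolynomial`** — a LOCALLY CONSTANT `P : Spec A → ℚ[X]` with both letters at every prime and
  EVERY cartesian square over `κ(𝔭)`, from Mumford's threshold `B(P 𝔭) − 1` on.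
* §4 `exists_isLocallyConstant_hilbertPolynomial_fieldPoint` — the same at EVERY field point `Spec K → Spec A` (value `P(ker)`), and
  **`exists_polynomial_forall_fieldPoint_pullback_twistMod_of_preconnectedSpace`** — the head of ★ §5 (ONE polynomial, ONE threshold,
  every field point) with «`A` a domain» replaced by «`Spec A` connected».

Cell hodgecm-mathlib, F-4 (II-b) Hom-scheme assembly (b4) (B-p20 (g14) census v2 §2 (b4): the test scheme splits into the clopen pieces
`T_P` on which ★ `Motives.exists_universal_flat_family` applies), B-p14 (g20).  Count-neutral capital: HC_CM is proved only modulo the 7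
printed citations until rung 0 closes; nothing here bears on it.

## References

* R. Hartshorne, *Algebraic Geometry*, GTM 52 (1977), III Thm. 9.9 (p. 261). [Hartshorne1977] · A. Grothendieck, *EGA III₂* (Publ. Math.
  IHÉS 17, 1963), 7.9.11. [EGAIII2] · D. Mumford, *Lectures on Curves on an Algebraic Surface* (1966), Lecture 8, 3° (ii).
  [Mumford1966CurvesSurface] · U. Görtz, T. Wedhorn, *Algebraic Geometry II* (2023), Cor. 22.91 (p. 277). [GortzWedhorn2023]
-/

noncomputable section

set_option backward.isDefEq.respectTransparency false

open CategoryTheory CategoryTheory.Limits CategoryTheory.Abelian AlgebraicGeometry TopologicalSpace Opposite Polynomial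
open Literature.Algebra.Homology Literature.Algebra.Homology.LaurentCech Literature.Algebra.Homology.OrderedCech
open Literature.AlgebraicGeometry.Morphisms.ProjCech
open Literature.AlgebraicGeometry.Modules Literature.AlgebraicGeometry.Modules.SerreTwist Literature.AlgebraicGeometry.Motives

namespace Literature.AlgebraicGeometry.Morphisms

/-! ## §0 Topology and two transports -/
section Topology

/-- **On a Noetherian quasi-sober space, a function constant along specialisations is locally constant**: every point `x` has the open
neighbourhood «complement of the (finitely many, closed) irreducible components not through `x`», every point `y` of which lies on an
irreducible component through `x`, whose generic point specialises to both. [cite: Hartshorne1977, III Thm. 9.9 (p. 261), remark]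
[cite: EGAIII2, 7.9.11] -/
theorem isLocallyConstant_of_specializes {X Y : Type*} [TopologicalSpace X] [NoetherianSpace X] [QuasiSober X] (f : X → Y)
    (hf : ∀ ⦃x y : X⦄, x ⤳ y → f x = f y) : IsLocallyConstant f := by
  rw [IsLocallyConstant.iff_exists_open]
  intro x
  set 𝒞 : Set (Set X) := {C ∈ irreducibleComponents X | x ∉ C} with h𝒞
  have hfin : 𝒞.Finite := NoetherianSpace.finite_irreducibleComponents.subset fun C hC => hC.1
  have hclosed : IsClosed (⋃ C ∈ 𝒞, C) :=
    hfin.isClosed_biUnion fun C hC => isClosed_of_mem_irreducibleComponents C hC.1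
  refine ⟨(⋃ C ∈ 𝒞, C)ᶜ, hclosed.isOpen_compl, ?_, fun y hy => ?_⟩
  · simp only [Set.mem_compl_iff, Set.mem_iUnion, exists_prop, not_exists, not_and]
    exact fun C hC hxC => hC.2 hxC
  · -- the irreducible component of `y` passes through `x`
    have hxC : x ∈ irreducibleComponent y := by
      by_contra h
      exact hy (Set.mem_biUnion (x := irreducibleComponent y)
        ⟨irreducibleComponent_mem_irreducibleComponents y, h⟩ mem_irreducibleComponent)
    have hξ : IsGenericPoint (isIrreducible_irreducibleComponent (x := y)).genericPoint (irreducibleComponent y) :=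
      isIrreducible_irreducibleComponent.isGenericPoint_genericPoint isClosed_irreducibleComponent
    exact (hf (hξ.specializes_iff_mem.mpr mem_irreducibleComponent)).symm.trans (hf (hξ.specializes_iff_mem.mpr hxC))

/-- `Ext`-vanishing transports along an isomorphism of the second argument. [folklore] -/
private theorem subsingleton_ext_of_iso'' {C : Type*} [Category C] [Abelian C] [HasExt.{1} C] (P : C) {Y Y' : C}
    (e : Y ≅ Y') (i : ℕ) (h : Subsingleton (Ext.{1} P Y' i)) : Subsingleton (Ext.{1} P Y i) := by
  refine subsingleton_of_forall_eq 0 fun x => ?_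
  have hx : x = (x.comp (Ext.mk₀ e.hom) (add_zero i)).comp (Ext.mk₀ e.inv) (add_zero i) := by
    rw [Ext.comp_assoc_of_second_deg_zero, Ext.mk₀_comp_mk₀, e.hom_inv_id, Ext.comp_mk₀_id]
  rw [hx, Subsingleton.elim (x.comp (Ext.mk₀ e.hom) (add_zero i)) 0, Ext.zero_comp]

/-- Two rational polynomials agreeing at every natural number beyond a threshold are equal. [folklore] -/
private theorem eq_of_forall_le_eval_eq (P Q : ℚ[X]) (n : ℕ) (h : ∀ e : ℕ, n ≤ e → P.eval (e : ℚ) = Q.eval (e : ℚ)) : P = Q := by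
  apply Polynomial.eq_of_infinite_eval_eq P Q
  refine Set.Infinite.mono (s := (fun e : ℕ => (e : ℚ)) '' {e : ℕ | n ≤ e}) ?_ ?_
  · rintro _ ⟨e, he, rfl⟩
    exact h e he
  · refine Set.Infinite.image (fun a _ b _ hab => by exact_mod_cast hab) ?_
    exact Set.infinite_of_forall_exists_gt fun m => ⟨max m n + 1, by change n ≤ max m n + 1; omega, by omega⟩

end Topology

/-! ## §1 Base change of an embedded family along a ring map, and field points read through it -/

section BaseChange

variable {A : Type} [CommRing A] {r : ℕ} {Z : Scheme.{0}} (ι : Z ⟶ PP A r) [IsClosedImmersion ι]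

/-- **The base change of an embedded family along any ring map is an embedded family.**  For an `A`-algebra `B` and a cartesian square
`Z_B = Z ×_A Spec B` (`k : Z_B ⟶ Z`, `f₀ : Z_B ⟶ Spec B` along `strZ ι`), the lift `ι_B : Z_B ⟶ 𝐏ʳ_B` into `𝐏ʳ_B = 𝐏ʳ_A ×_A Spec B`
(★ `ProjBaseChangeAny.isPullback_projMap'`) is a closed immersion with structure map `f₀`, and the twists transport:
`k^*𝒪_Z(e) ≅ 𝒪_{Z_B}(e)` (★ `SerreTwist.exists_pullback_twistMod_iso_of_sq`). [cite: Hartshorne1977, II Ex. 3.10 and III Cor. 9.4]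
[cite: Liu2002, Prop. 3.1.9 and Ex. 3.1.10] -/
theorem exists_embedding_of_isPullback {B : Type} [CommRing B] [Algebra A B] {X₀ : Scheme.{0}} (k : X₀ ⟶ Z)
    (f₀ : X₀ ⟶ Spec (CommRingCat.of B)) (H : IsPullback k f₀ (strZ ι) (Spec.map (CommRingCat.ofHom (algebraMap A B)))) :
    ∃ (ιB : X₀ ⟶ PP B r) (_ : IsClosedImmersion ιB), strZ ιB = f₀ ∧
      ∀ e : ℕ, Nonempty ((Scheme.Modules.pullback k).obj (twistMod ι (unitModule Z) e) ≅ twistMod ιB (unitModule X₀) e) := by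
  have HP := ProjBaseChangeRing.isPullback_projMap' A B (n := r)
  have hw : (k ≫ ι) ≫ toSpec A r = f₀ ≫ Spec.map (CommRingCat.ofHom (algebraMap A B)) := by
    rw [Category.assoc]; exact H.w
  let ιB : X₀ ⟶ PP B r := HP.lift (k ≫ ι) f₀ hw
  have h1 := HP.lift_fst _ _ hw
  have h2 : strZ ιB = f₀ := HP.lift_snd _ _ hw
  have big : IsPullback k (ιB ≫ toSpec B r) (ι ≫ toSpec A r) (Spec.map (CommRingCat.ofHom (algebraMap A B))) := by
    rw [show ιB ≫ toSpec B r = f₀ from h2]; exact H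
  have sq := IsPullback.of_bot big h1.symm HP
  haveI : IsClosedImmersion ιB := MorphismProperty.of_isPullback (P := @IsClosedImmersion) sq inferInstance
  refine ⟨ιB, inferInstance, h2, fun e => ?_⟩
  obtain ⟨φ, -⟩ := exists_pullback_twistMod_iso_of_sq A B k ι ιB h1.symm e
  exact ⟨φ⟩

omit [IsClosedImmersion ι] in
/-- **A field point of `Spec B` reads the same fibre on `Z` and on `Z_B = Z ×_A Spec B`.**  Given the base change (`g : Z_B ⟶ Z` cartesian
over `Spec B ⟶ Spec A`, an embedding `ι_B` with `strZ ι_B` the projection and `g^*𝒪_Z(e) ≅ 𝒪_{Z_B}(e)`) and a cartesian square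
`(k, f₀)` of `Z` over a field point `x_B ≫ (Spec B → Spec A)`, the lift `k' : X₀ ⟶ Z_B` is cartesian over `x_B` and
`k^*𝒪_Z(e) ≅ k'^*𝒪_{Z_B}(e)`. [cite: Liu2002, Prop. 3.1.9 and Ex. 3.1.10] -/
theorem exists_lift_fieldPoint {B : Type} [CommRing B] [Algebra A B] {ZB : Scheme.{0}} (g : ZB ⟶ Z) (ιB : ZB ⟶ PP B r)
    (HB : IsPullback g (strZ ιB) (strZ ι) (Spec.map (CommRingCat.ofHom (algebraMap A B))))
    (φ : ∀ e : ℕ, (Scheme.Modules.pullback g).obj (twistMod ι (unitModule Z) e) ≅ twistMod ιB (unitModule ZB) e)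
    {K : Type} [Field K] {X₀ : Scheme.{0}} (k : X₀ ⟶ Z) (f₀ : X₀ ⟶ Spec (CommRingCat.of K))
    (xB : Spec (CommRingCat.of K) ⟶ Spec (CommRingCat.of B))
    (H : IsPullback k f₀ (strZ ι) (xB ≫ Spec.map (CommRingCat.ofHom (algebraMap A B)))) :
    ∃ k' : X₀ ⟶ ZB, k' ≫ g = k ∧ IsPullback k' f₀ (strZ ιB) xB ∧
      ∀ e : ℕ, Nonempty ((Scheme.Modules.pullback k).obj (twistMod ι (unitModule Z) e) ≅
        (Scheme.Modules.pullback k').obj (twistMod ιB (unitModule ZB) e)) := by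
  let k' : X₀ ⟶ ZB := HB.lift k (f₀ ≫ xB) (by rw [Category.assoc]; exact H.w)
  have hk : k' ≫ g = k := HB.lift_fst _ _ _
  have hf : k' ≫ strZ ιB = f₀ ≫ xB := HB.lift_snd _ _ _
  clear_value k'
  subst hk
  refine ⟨k', rfl, IsPullback.of_right H hf HB, fun e => ⟨?_⟩⟩
  exact ((Scheme.Modules.pullbackComp k' g).app (twistMod ι (unitModule Z) e)).symm ≪≫
    (Scheme.Modules.pullback k').mapIso (φ e)

end BaseChange

/-! ## §2 Specialisation: the Hilbert polynomial at `κ(𝔮)` equals that at `κ(𝔭)` for `𝔭 ≤ 𝔮` -/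

section Specialisation

variable {A : Type} [CommRing A] [IsNoetherianRing A] {r : ℕ} (hr : 1 ≤ r) {Z : Scheme.{0}} (ι : Z ⟶ PP A r)
  [IsClosedImmersion ι] [IsProper (strZ ι)] [Flat (strZ ι)]

include hr in
/-- **Over the closed subscheme `Spec (A ⧸ 𝔭)` there is ONE polynomial for ALL fibres** (Hartshorne III 9.9 on the pulled-back family,
which is flat and proper over the Noetherian DOMAIN `A ⧸ 𝔭`): `∃ P e₀` such that at every field point `x_B : Spec K → Spec (A ⧸ 𝔭)`,
every cartesian square of `Z` over `x_B ≫ (Spec (A ⧸ 𝔭) → Spec A)` and every `e ≥ e₀`, both letters hold with `P`.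
[cite: Hartshorne1977, III Thm. 9.9 (p. 261)] [cite: GortzWedhorn2023, Cor. 22.91 (p. 277)] -/
theorem exists_polynomial_forall_fieldPoint_over_quotient (𝔭 : Ideal A) [𝔭.IsPrime] :
    ∃ (P : ℚ[X]) (e₀ : ℕ), ∀ ⦃K : Type⦄ [Field K] ⦃X₀ : Scheme.{0}⦄ (k : X₀ ⟶ Z) (f₀ : X₀ ⟶ Spec (CommRingCat.of K))
      (xB : Spec (CommRingCat.of K) ⟶ Spec (CommRingCat.of (A ⧸ 𝔭))),
      IsPullback k f₀ (strZ ι) (xB ≫ Spec.map (CommRingCat.ofHom (algebraMap A (A ⧸ 𝔭)))) → ∀ e : ℕ, e₀ ≤ e →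
        Subsingleton (Ext.{1} (unitModule X₀) ((Scheme.Modules.pullback k).obj (twistMod ι (unitModule Z) e)) 1) ∧
        ((Module.finrank Γ(Spec (CommRingCat.of K), ⊤)
          (SecMod ((Scheme.Modules.pullback k).obj (twistMod ι (unitModule Z) e)) f₀.appTop.hom ⊤) : ℕ) : ℚ) =
            P.eval (e : ℚ) := by
  -- the base change `Z_B = Z ×_A Spec (A ⧸ 𝔭)`, embedded in `𝐏ʳ_{A ⧸ 𝔭}`
  set B : Type := A ⧸ 𝔭 with hBdef
  have HB := IsPullback.of_hasPullback (strZ ι) (Spec.map (CommRingCat.ofHom (algebraMap A B)))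
  obtain ⟨ιB, _, hιB, hφ⟩ := exists_embedding_of_isPullback ι (pullback.fst (strZ ι) _) (pullback.snd (strZ ι) _) HB
  have HB' : IsPullback (pullback.fst (strZ ι) (Spec.map (CommRingCat.ofHom (algebraMap A B)))) (strZ ιB) (strZ ι)
      (Spec.map (CommRingCat.ofHom (algebraMap A B))) := by rw [hιB]; exact HB
  haveI : IsProper (strZ ιB) := by rw [hιB]; exact MorphismProperty.of_isPullback HB inferInstance
  haveI : Flat (strZ ιB) := by rw [hιB]; exact MorphismProperty.of_isPullback HB inferInstance
  -- Hartshorne III 9.9 over the Noetherian domain `A ⧸ 𝔭`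
  obtain ⟨P, e₀, hP⟩ := exists_polynomial_forall_fieldPoint_pullback_twistMod' hr ιB
  refine ⟨P, e₀, fun K _ X₀ k f₀ xB H e he => ?_⟩
  obtain ⟨k', hk', H', hψ⟩ := exists_lift_fieldPoint ι (pullback.fst (strZ ι) _) ιB HB' (fun e => (hφ e).some) k f₀ xB H
  obtain ⟨hvan, hrk⟩ := hP k' f₀ xB H' e he
  refine ⟨subsingleton_ext_of_iso'' (unitModule X₀) (hψ e).some 1 hvan, ?_⟩
  obtain ⟨L, -⟩ := exists_secMod_linearEquiv_of_iso f₀.appTop.hom (hψ e).some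
  rw [L.finrank_eq]
  exact hrk

include hr in
/-- **SPECIALISATION (Hartshorne III 9.9 beyond integral bases).**  For primes `𝔭 ≤ 𝔮` of a Noetherian ring `A` and a flat embedded
family `Z ⊆ 𝐏ʳ_A`: if `QZ₁` reads the ranks `dim_{κ(𝔭)} Γ(X₁, k₁^*𝒪_Z(e))` of a `κ(𝔭)`-fibre for `e ≥ e₁` and `QZ₂` reads those of a
`κ(𝔮)`-fibre for `e ≥ e₂` (any cartesian squares), then `QZ₁ = QZ₂` — both field points factor through `Spec (A ⧸ 𝔭)`, over which
★ §5 gives ONE polynomial. [cite: Hartshorne1977, III Thm. 9.9 (p. 261)] [cite: EGAIII2, 7.9.11] -/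
theorem hilbertPolynomial_eq_of_le (𝔭 𝔮 : Ideal A) [𝔭.IsPrime] [𝔮.IsPrime] (hle : 𝔭 ≤ 𝔮)
    {X₁ : Scheme.{0}} {k₁ : X₁ ⟶ Z} {f₁ : X₁ ⟶ Spec (CommRingCat.of 𝔭.ResidueField)}
    (H₁ : IsPullback k₁ f₁ (strZ ι) (Spec.map (CommRingCat.ofHom (algebraMap A 𝔭.ResidueField))))
    {X₂ : Scheme.{0}} {k₂ : X₂ ⟶ Z} {f₂ : X₂ ⟶ Spec (CommRingCat.of 𝔮.ResidueField)}
    (H₂ : IsPullback k₂ f₂ (strZ ι) (Spec.map (CommRingCat.ofHom (algebraMap A 𝔮.ResidueField))))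
    (QZ₁ QZ₂ : ℚ[X]) (e₁ e₂ : ℕ)
    (h₁ : ∀ e : ℕ, e₁ ≤ e → ((Module.finrank Γ(Spec (CommRingCat.of 𝔭.ResidueField), ⊤)
        (SecMod ((Scheme.Modules.pullback k₁).obj (twistMod ι (unitModule Z) e)) f₁.appTop.hom ⊤) : ℕ) : ℚ) =
        QZ₁.eval (e : ℚ))
    (h₂ : ∀ e : ℕ, e₂ ≤ e → ((Module.finrank Γ(Spec (CommRingCat.of 𝔮.ResidueField), ⊤)
        (SecMod ((Scheme.Modules.pullback k₂).obj (twistMod ι (unitModule Z) e)) f₂.appTop.hom ⊤) : ℕ) : ℚ) =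
        QZ₂.eval (e : ℚ)) :
    QZ₁ = QZ₂ := by
  obtain ⟨P, e₀, hP⟩ := exists_polynomial_forall_fieldPoint_over_quotient hr ι 𝔭
  -- both residue fields are `(A ⧸ 𝔭)`-algebras compatibly with `A`
  let ψ₁ : A ⧸ 𝔭 →+* 𝔭.ResidueField :=
    Ideal.Quotient.lift 𝔭 (algebraMap A 𝔭.ResidueField) fun a ha => Ideal.algebraMap_residueField_eq_zero.mpr ha
  let ψ₂ : A ⧸ 𝔭 →+* 𝔮.ResidueField :=
    Ideal.Quotient.lift 𝔭 (algebraMap A 𝔮.ResidueField) fun a ha => Ideal.algebraMap_residueField_eq_zero.mpr (hle ha)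
  have hψ₁ : Spec.map (CommRingCat.ofHom (algebraMap A 𝔭.ResidueField)) =
      Spec.map (CommRingCat.ofHom ψ₁) ≫ Spec.map (CommRingCat.ofHom (algebraMap A (A ⧸ 𝔭))) := by
    rw [← Spec.map_comp, ← CommRingCat.ofHom_comp]
    rfl
  have hψ₂ : Spec.map (CommRingCat.ofHom (algebraMap A 𝔮.ResidueField)) =
      Spec.map (CommRingCat.ofHom ψ₂) ≫ Spec.map (CommRingCat.ofHom (algebraMap A (A ⧸ 𝔭))) := by
    rw [← Spec.map_comp, ← CommRingCat.ofHom_comp]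
    rfl
  rw [hψ₁] at H₁
  rw [hψ₂] at H₂
  have hQ₁ : QZ₁ = P := eq_of_forall_le_eval_eq QZ₁ P (max e₀ e₁) fun e he =>
    (h₁ e ((le_max_right _ _).trans he)).symm.trans (hP k₁ f₁ _ H₁ e ((le_max_left _ _).trans he)).2
  have hQ₂ : QZ₂ = P := eq_of_forall_le_eval_eq QZ₂ P (max e₀ e₂) fun e he =>
    (h₂ e ((le_max_right _ _).trans he)).symm.trans (hP k₂ f₂ _ H₂ e ((le_max_left _ _).trans he)).2
  rw [hQ₁, hQ₂]

end Specialisation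

/-! ## §3 Local constancy on `Spec A` -/

section LocallyConstant

variable {A : Type} [CommRing A] [IsNoetherianRing A] {r : ℕ} (hr : 1 ≤ r) {Z : Scheme.{0}} (ι : Z ⟶ PP A r)
  [IsClosedImmersion ι] [IsProper (strZ ι)] [Flat (strZ ι)]

include hr in
/-- **The Hilbert polynomial of the fibres of a FLAT projective family over a Noetherian ring is a LOCALLY CONSTANT function on
`Spec A`** (Hartshorne III 9.9 and the remark after it; EGA III 7.9.11): there is `P : Spec A → ℚ[X]`, locally constant, such that at
every prime `𝔭` and EVERY cartesian square `X₀ = Z ×_A Spec κ(𝔭)` both letters hold with `P 𝔭` for `e ≥ B(P 𝔭) − 1` (Mumford's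
regularity threshold): `Ext¹(𝒪_{X₀}, k^*𝒪_Z(e)) = 0` and `dim_{κ(𝔭)} Γ(X₀, k^*𝒪_Z(e)) = (P 𝔭)(e)`.  The value `P 𝔭` is the polynomial of
★ `exists_hilbertPolynomial_residueField_fibre`; it does not depend on the square (§2 at `𝔭 = 𝔭`), it is constant along specialisations
(§2) and hence locally constant (§0). [cite: Hartshorne1977, III Thm. 9.9 (p. 261)] [cite: EGAIII2, 7.9.11]
[cite: Mumford1966CurvesSurface, Lecture 8, 3° (ii)] -/
theorem exists_isLocallyConstant_hilbertPolynomial :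
    ∃ P : PrimeSpectrum A → ℚ[X], IsLocallyConstant P ∧
      ∀ (x : PrimeSpectrum A) ⦃X₀ : Scheme.{0}⦄ (k : X₀ ⟶ Z) (f₀ : X₀ ⟶ Spec (CommRingCat.of x.asIdeal.ResidueField)),
        IsPullback k f₀ (strZ ι) (Spec.map (CommRingCat.ofHom (algebraMap A x.asIdeal.ResidueField))) →
        ∀ e : ℕ, regularityBound (preHilbertPoly ℚ r 0) 0 (preHilbertPoly ℚ r 0 - P x) - 1 ≤ (e : ℤ) →
          Subsingleton (Ext.{1} (unitModule X₀) ((Scheme.Modules.pullback k).obj (twistMod ι (unitModule Z) e)) 1) ∧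
          ((Module.finrank Γ(Spec (CommRingCat.of x.asIdeal.ResidueField), ⊤)
            (SecMod ((Scheme.Modules.pullback k).obj (twistMod ι (unitModule Z) e)) f₀.appTop.hom ⊤) : ℕ) : ℚ) =
              (P x).eval (e : ℚ) := by
  -- at each prime: the canonical square and its polynomial (★ §5)
  have fibre : ∀ x : PrimeSpectrum A, ∃ (X₁ : Scheme.{0}) (k₁ : X₁ ⟶ Z)
      (f₁ : X₁ ⟶ Spec (CommRingCat.of x.asIdeal.ResidueField))
      (_ : IsPullback k₁ f₁ (strZ ι) (Spec.map (CommRingCat.ofHom (algebraMap A x.asIdeal.ResidueField)))) (QZ : ℚ[X]),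
      ∀ e : ℕ, regularityBound (preHilbertPoly ℚ r 0) 0 (preHilbertPoly ℚ r 0 - QZ) - 1 ≤ (e : ℤ) →
        Subsingleton (Ext.{1} (unitModule X₁) ((Scheme.Modules.pullback k₁).obj (twistMod ι (unitModule Z) e)) 1) ∧
        ((Module.finrank Γ(Spec (CommRingCat.of x.asIdeal.ResidueField), ⊤)
          (SecMod ((Scheme.Modules.pullback k₁).obj (twistMod ι (unitModule Z) e)) f₁.appTop.hom ⊤) : ℕ) : ℚ) =
          QZ.eval (e : ℚ) := by
    intro x
    have H₁ := IsPullback.of_hasPullback (strZ ι) (Spec.map (CommRingCat.ofHom (algebraMap A x.asIdeal.ResidueField)))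
    obtain ⟨QZ, hQZ⟩ := exists_hilbertPolynomial_residueField_fibre hr ι x.asIdeal _ _ H₁
    exact ⟨_, _, _, H₁, QZ, hQZ⟩
  choose X₁ k₁ f₁ H₁ P hP using fibre
  -- thresholds as naturals
  have hthr : ∀ (Q : ℚ[X]) (e : ℕ), (regularityBound (preHilbertPoly ℚ r 0) 0 (preHilbertPoly ℚ r 0 - Q) - 1).toNat ≤ e →
      regularityBound (preHilbertPoly ℚ r 0) 0 (preHilbertPoly ℚ r 0 - Q) - 1 ≤ (e : ℤ) := fun Q e he => by
    have := Int.self_le_toNat (regularityBound (preHilbertPoly ℚ r 0) 0 (preHilbertPoly ℚ r 0 - Q) - 1)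
    omega
  refine ⟨P, ?_, fun x X₀ k f₀ H e he => ?_⟩
  · -- constant along specialisations `x ⤳ y` (`x.asIdeal ≤ y.asIdeal`), hence locally constant
    refine isLocallyConstant_of_specializes P fun x y hxy => ?_
    have hle : x.asIdeal ≤ y.asIdeal := (PrimeSpectrum.le_iff_specializes x y).mpr hxy
    exact hilbertPolynomial_eq_of_le hr ι x.asIdeal y.asIdeal hle (H₁ x) (H₁ y) (P x) (P y) _ _
      (fun e he => (hP x e (hthr _ e he)).2) (fun e he => (hP y e (hthr _ e he)).2)
  · -- any other square at `x` has the same polynomial (§2 at `𝔭 ≤ 𝔭`)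
    obtain ⟨QZ, hQZ⟩ := exists_hilbertPolynomial_residueField_fibre hr ι x.asIdeal k f₀ H
    have hPQ : QZ = P x := hilbertPolynomial_eq_of_le hr ι x.asIdeal x.asIdeal le_rfl H (H₁ x) QZ (P x) _ _
      (fun e he => (hQZ e (hthr _ e he)).2) (fun e he => (hP x e (hthr _ e he)).2)
    subst hPQ
    exact hQZ e he

end LocallyConstant

/-! ## §4 The letters at ARBITRARY field points, and ONE polynomial over a CONNECTED base -/

section FieldPoint

variable {A : Type} [CommRing A] [IsNoetherianRing A] {r : ℕ} (hr : 1 ≤ r) {Z : Scheme.{0}} (ι : Z ⟶ PP A r)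
  [IsClosedImmersion ι] [IsProper (strZ ι)] [Flat (strZ ι)]

include hr in
/-- **The locally constant Hilbert polynomial serves EVERY field point** (not only residue fields): with the `P` of §3, for every ring
map `φ : A → K` to a field, every cartesian square `X₀ = Z ×_A Spec K` over `Spec φ` and every `e ≥ B(P(ker φ)) − 1`:
`Ext¹(𝒪_{X₀}, k^*𝒪_Z(e)) = 0` and `dim_K Γ(X₀, k^*𝒪_Z(e)) = P(ker φ)(e)` — `φ` factors through `ψ : κ(ker φ) → K` and both letters
ascend along the field extension `ψ` (★ `subsingleton_ext_unit_succ_iff_of_isPullback_specMap`, ★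
`finrank_secMod_top_eq_of_isPullback_specMap`). [cite: Hartshorne1977, III Thm. 9.9 (p. 261)] [cite: EGAIII2, 7.9.11]
[cite: GortzWedhorn2023, Cor. 22.91 (p. 277)] -/
theorem exists_isLocallyConstant_hilbertPolynomial_fieldPoint :
    ∃ P : PrimeSpectrum A → ℚ[X], IsLocallyConstant P ∧
      ∀ ⦃K : Type⦄ [Field K] ⦃X₀ : Scheme.{0}⦄ (k : X₀ ⟶ Z) (f₀ : X₀ ⟶ Spec (CommRingCat.of K)) (φ : A →+* K),
        IsPullback k f₀ (strZ ι) (Spec.map (CommRingCat.ofHom φ)) →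
        ∀ e : ℕ, regularityBound (preHilbertPoly ℚ r 0) 0
            (preHilbertPoly ℚ r 0 - P ⟨RingHom.ker φ, RingHom.ker_isPrime φ⟩) - 1 ≤ (e : ℤ) →
          Subsingleton (Ext.{1} (unitModule X₀) ((Scheme.Modules.pullback k).obj (twistMod ι (unitModule Z) e)) 1) ∧
          ((Module.finrank Γ(Spec (CommRingCat.of K), ⊤)
            (SecMod ((Scheme.Modules.pullback k).obj (twistMod ι (unitModule Z) e)) f₀.appTop.hom ⊤) : ℕ) : ℚ) =
              (P ⟨RingHom.ker φ, RingHom.ker_isPrime φ⟩).eval (e : ℚ) := by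
  obtain ⟨P, hP, hletters⟩ := exists_isLocallyConstant_hilbertPolynomial hr ι
  refine ⟨P, hP, fun K _ X₀ k f₀ φ H e he => ?_⟩
  -- `φ` factors through `ψ : κ(𝔭) → K`, `𝔭 = ker φ`
  set 𝔭 : Ideal A := RingHom.ker φ with h𝔭
  haveI : 𝔭.IsPrime := RingHom.ker_isPrime φ
  have hunit : 𝔭.primeCompl ≤ (IsUnit.submonoid K).comap φ := fun a ha =>
    isUnit_iff_ne_zero.mpr fun h => ha ((RingHom.mem_ker).mpr h)
  set ψ : 𝔭.ResidueField →+* K := Ideal.ResidueField.lift 𝔭 φ le_rfl hunit with hψ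
  have hφ : CommRingCat.ofHom φ =
      CommRingCat.ofHom (algebraMap A 𝔭.ResidueField) ≫ CommRingCat.ofHom ψ := by
    ext a
    change φ a = ψ (algebraMap A 𝔭.ResidueField a)
    rw [hψ, Ideal.ResidueField.lift_algebraMap]
  rw [hφ, Spec.map_comp] at H
  -- the canonical residue-field square at `𝔭` and its letters with `P 𝔭`
  let x𝔭 : PrimeSpectrum A := ⟨𝔭, inferInstance⟩
  have H₂ := IsPullback.of_hasPullback (strZ ι) (Spec.map (CommRingCat.ofHom (algebraMap A 𝔭.ResidueField)))
  set k₂ := pullback.fst (strZ ι) (Spec.map (CommRingCat.ofHom (algebraMap A 𝔭.ResidueField)))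
  set f₂ := pullback.snd (strZ ι) (Spec.map (CommRingCat.ofHom (algebraMap A 𝔭.ResidueField)))
  obtain ⟨hvan₂, hrk₂⟩ := hletters x𝔭 k₂ f₂ H₂ e he
  -- `X₀ → X₂` over `Spec K → Spec κ(𝔭)` is cartesian
  let k' : X₀ ⟶ pullback (strZ ι) (Spec.map (CommRingCat.ofHom (algebraMap A 𝔭.ResidueField))) :=
    H₂.lift k (f₀ ≫ Spec.map (CommRingCat.ofHom ψ)) (by rw [Category.assoc]; exact H.w)
  have hk' : k' ≫ k₂ = k := H₂.lift_fst _ _ _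
  have hf' : k' ≫ f₂ = f₀ ≫ Spec.map (CommRingCat.ofHom ψ) := H₂.lift_snd _ _ _
  clear_value k'
  subst hk'
  have Hsq : IsPullback k' f₀ f₂ (Spec.map (CommRingCat.ofHom ψ)) := IsPullback.of_right H hf' H₂
  haveI : IsProper f₂ := MorphismProperty.of_isPullback H₂ inferInstance
  have hG : IsAffineLocalizing ((Scheme.Modules.pullback k₂).obj (twistMod ι (unitModule Z) e)) :=
    IsAffineLocalizing.pullback k₂ (isAffineLocalizing_twistMod_unitModule ι e)
  -- transport along `k'^* k₂^* ≅ (k' ≫ k₂)^*` and ascend along `κ(𝔭) → K`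
  let Φ := (Scheme.Modules.pullbackComp k' k₂).app (twistMod ι (unitModule Z) e)
  refine ⟨?_, ?_⟩
  · have h : Subsingleton (Ext.{1} (unitModule X₀) ((Scheme.Modules.pullback k').obj
        ((Scheme.Modules.pullback k₂).obj (twistMod ι (unitModule Z) e))) 1) :=
      (subsingleton_ext_unit_succ_iff_of_isPullback_specMap ψ Hsq
        ((Scheme.Modules.pullback k₂).obj (twistMod ι (unitModule Z) e)) hG 0).mpr hvan₂
    exact subsingleton_ext_of_iso'' (unitModule X₀) Φ.symm 1 h
  · obtain ⟨Lin, -⟩ := exists_secMod_linearEquiv_of_iso f₀.appTop.hom Φ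
    rw [← Lin.finrank_eq]
    change ((Module.finrank Γ(Spec (CommRingCat.of K), ⊤) (SecMod ((Scheme.Modules.pullback k').obj
      ((Scheme.Modules.pullback k₂).obj (twistMod ι (unitModule Z) e))) f₀.appTop.hom ⊤) : ℕ) : ℚ) = _
    rw [finrank_secMod_top_eq_of_isPullback_specMap ψ Hsq _ hG]
    exact hrk₂

include hr in
/-- **Hartshorne III 9.9 uniformly over ALL field points of a CONNECTED Noetherian base** (not necessarily integral): for a FLAT closed
family `ι : Z ⊆ 𝐏ʳ_A` with `Spec A` connected there are ONE polynomial `P` and ONE threshold `e₀` such that for every field-valued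
point `x : Spec K → Spec A`, every cartesian square `X₀ = Z ×_A Spec K` and every `e ≥ e₀`: `Ext¹(𝒪_{X₀}, k^*𝒪_Z(e)) = 0` and
`dim_K Γ(X₀, k^*𝒪_Z(e)) = P(e)` (the locally constant `P` is constant on the connected `Spec A`) — the form ★
`Modules/ProjectiveFamilyTwistPushforward.hasRank_pushforward_twistMod_of_forall_fieldPoint` and ★ `Motives.exists_universal_flat_family`
consume on each clopen piece of a test scheme. [cite: Hartshorne1977, III Thm. 9.9 (p. 261)] [cite: EGAIII2, 7.9.11] -/
theorem exists_polynomial_forall_fieldPoint_pullback_twistMod_of_preconnectedSpace [PreconnectedSpace (PrimeSpectrum A)] :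
    ∃ (P : ℚ[X]) (e₀ : ℕ), ∀ ⦃K : Type⦄ [Field K] ⦃X₀ : Scheme.{0}⦄ (k : X₀ ⟶ Z) (f₀ : X₀ ⟶ Spec (CommRingCat.of K))
      (x : Spec (CommRingCat.of K) ⟶ Spec (CommRingCat.of A)), IsPullback k f₀ (strZ ι) x → ∀ e : ℕ, e₀ ≤ e →
        Subsingleton (Ext.{1} (unitModule X₀) ((Scheme.Modules.pullback k).obj (twistMod ι (unitModule Z) e)) 1) ∧
        ((Module.finrank Γ(Spec (CommRingCat.of K), ⊤)
          (SecMod ((Scheme.Modules.pullback k).obj (twistMod ι (unitModule Z) e)) f₀.appTop.hom ⊤) : ℕ) : ℚ) =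
            P.eval (e : ℚ) := by
  obtain ⟨P, hP, hletters⟩ := exists_isLocallyConstant_hilbertPolynomial_fieldPoint hr ι
  rcases isEmpty_or_nonempty (PrimeSpectrum A) with hA | hne
  · refine ⟨0, 0, fun K _ X₀ k f₀ x H e he => ?_⟩
    obtain ⟨φ, -⟩ : ∃ φ : A →+* K, x = Spec.map (CommRingCat.ofHom φ) :=
      ⟨(Spec.preimage x).hom, by rw [CommRingCat.ofHom_hom, Spec.map_preimage]⟩
    exact (hA.false ⟨RingHom.ker φ, RingHom.ker_isPrime φ⟩).elim
  obtain ⟨x₀⟩ := hne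
  refine ⟨P x₀, (regularityBound (preHilbertPoly ℚ r 0) 0 (preHilbertPoly ℚ r 0 - P x₀) - 1).toNat, ?_⟩
  intro K _ X₀ k f₀ x H e he
  obtain ⟨φ, rfl⟩ : ∃ φ : A →+* K, x = Spec.map (CommRingCat.ofHom φ) :=
    ⟨(Spec.preimage x).hom, by rw [CommRingCat.ofHom_hom, Spec.map_preimage]⟩
  have hPx : P ⟨RingHom.ker φ, RingHom.ker_isPrime φ⟩ = P x₀ := hP.apply_eq_of_preconnectedSpace _ x₀
  have he' : regularityBound (preHilbertPoly ℚ r 0) 0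
      (preHilbertPoly ℚ r 0 - P ⟨RingHom.ker φ, RingHom.ker_isPrime φ⟩) - 1 ≤ (e : ℤ) := by
    rw [hPx]
    have := Int.self_le_toNat (regularityBound (preHilbertPoly ℚ r 0) 0 (preHilbertPoly ℚ r 0 - P x₀) - 1)
    omega
  rw [← hPx]
  exact hletters k f₀ φ H e he'

end FieldPoint

end Literature.AlgebraicGeometry.Morphisms

end
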